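import Summits.QuantumFields.QCD.Theses.QuarksAsStableAction

/-!
# Crux `LightQuarkCompletion` (stmt-QuantumFields-18066) — line `Sketch`, stub `stub_chiralCompletion17661`:
# by-name reduction onto `QuarksAsStableAction.MassContinuation` + `QuarksAsStableAction.ChiralTupleGapless`

Worker file for the registered stub `LightQuarkJumpLine.stub_chiralCompletion17661` of skeleton rev 4 (lead
prover-line-stmt-QuantumFields-18066-c3-0, 2026-08-17).  The stub is VERBATIM the text of the sibling route item
`HeavyThresholdYMBridge.ChiralCompletion` (stmt-QuantumFields-17661): for `N_f ∈ {2,3}`, every regularisation `reg` with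
`HasMassScaling` that carries the `QCDOf` body at every tuple above SOME threshold `M₀` carries it, after ONE constant RGI
re-pin `δ` of its critical mass (`reg.scheme (fun f => m f + δ)`), at EVERY positive tuple, and is chiral at zero there.

**Result (registered helper `stub_chiralCompletion17661_of_massContinuation`).**  The stub follows BY PURE LOGIC (order
theory of `ℝ`) from two existing route items BY NAME:

* `QuarksAsStableAction.MassContinuation` (stmt-QuantumFields-18327, "the massive phase is open below a uniformly gapped
  threshold"): body above `M` + ONE lattice-gap rate `ε` on the half-orthant above `M` ⟹ body above `M − δ` for some `δ > 0`;
* `QuarksAsStableAction.ChiralTupleGapless` (stmt-QuantumFields-18328, "the chiral tuple is gapless"): body above some `M`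
  ⟹ some tuple `m₀` has no lattice gap at any positive rate.

Mechanism = the LEAST ADMISSIBLE THRESHOLD (adapted from the planner sketch
`Cruxes/StableActionBridge/Lines/least_threshold.lean`, which derives `QCDOf` the same way but for a re-centred
regularisation; here the conclusion is read on the δ-shifted SCHEME of the given `reg`, exactly as item 17661 states it):
the admissible thresholds `S = {M | body above M}` form an upper set containing `M₀`; the gapless tuple bounds `S` below
(a threshold below its least component would gap it — `HasLatticeMassGap` never reads the species renormalisations
`z, shift`); `M⋆ = sInf S` is admissible (finitely many components leave room, `exists_lt_of_csInf_lt`); and the lattice gap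
CLOSES above `M⋆` at every rate (else `MassContinuation` makes `M⋆ − δ` admissible, below the infimum, `csInf_le`).  Then
`δ := M⋆` is the re-pin: a positive tuple `m` shifted by `M⋆` lies above `M⋆` (body), and a tuple above `M⋆` without rate-`ε`
gap is a positive tuple shifted by `M⋆` (chirality at zero).  No sign condition on `M⋆`; `HasMassScaling` is only passed on.

Nothing in this file asserts a Theses decl: both items enter as hypotheses BY NAME of the registered helper.
-/

namespace Summit.QuantumFields.QCD.Theorems.LightQuarkJumpLine

open Literature.MathematicalPhysics.QuantumFieldTheory

/-! ## §1 The abstract extremal argument: the least admissible threshold -/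

/-- **Least-threshold lemma** (order theory on `ℝ`, `Fin N_f` non-empty).  `P m` = "the tuple `m` is good", `G m ε` =
"rate-`ε` gap at `m`".  If good tuples are gapped at some positive rate, some threshold is admissible (`P` above it),
admissibility descends strictly below every uniformly gapped admissible threshold, and some tuple is gapless at every
positive rate, then the INFIMUM of the admissible thresholds is admissible and the gap closes above it at every rate.
[folklore] -/
-- adapted from Cruxes/StableActionBridge/Lines/least_threshold.lean (`exists_least_threshold`)
theorem exists_leastThreshold {Nf : ℕ} [Nonempty (Fin Nf)] (P : (Fin Nf → ℝ) → Prop) (G : (Fin Nf → ℝ) → ℝ → Prop)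
    (hPG : ∀ m, P m → ∃ Δ > 0, G m Δ)
    (hT : ∃ M₀ : ℝ, ∀ m, (∀ f, M₀ < m f) → P m)
    (hO : ∀ M ε : ℝ, 0 < ε → (∀ m, (∀ f, M < m f) → P m) → (∀ m, (∀ f, M < m f) → G m ε) →
      ∃ δ > 0, ∀ m, (∀ f, M - δ < m f) → P m)
    (hG : ∃ m₀, ∀ Δ, 0 < Δ → ¬ G m₀ Δ) :
    ∃ M : ℝ, (∀ m, (∀ f, M < m f) → P m) ∧ ∀ ε > 0, ∃ m, (∀ f, M < m f) ∧ ¬ G m ε := by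
  classical
  -- the set of admissible thresholds: an upper set of `ℝ`
  set S : Set ℝ := {M | ∀ m : Fin Nf → ℝ, (∀ f, M < m f) → P m} with hS
  obtain ⟨M₀, hM₀⟩ := hT
  have hne : S.Nonempty := ⟨M₀, hM₀⟩
  -- the gapless tuple bounds the admissible thresholds from below by its least component
  obtain ⟨m₀, hm₀⟩ := hG
  have hbdd : BddBelow S := by
    refine ⟨Finset.univ.inf' Finset.univ_nonempty m₀, fun M hM => ?_⟩
    by_contra hlt
    push Not at hlt
    have hall : ∀ f, M < m₀ f := fun f =>
      lt_of_lt_of_le hlt (Finset.inf'_le _ (Finset.mem_univ f))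
    obtain ⟨Δ, hΔ, hgap⟩ := hPG m₀ (hM m₀ hall)
    exact hm₀ Δ hΔ hgap
  -- (1) the infimum is admissible: a tuple above it has its least component above some admissible threshold
  have hinf : ∀ m : Fin Nf → ℝ, (∀ f, sInf S < m f) → P m := by
    intro m hm
    have hlt : sInf S < Finset.univ.inf' Finset.univ_nonempty m :=
      (Finset.lt_inf'_iff _).2 fun f _ => hm f
    obtain ⟨M, hMS, hMt⟩ := exists_lt_of_csInf_lt hne hlt
    exact hMS m fun f => lt_of_lt_of_le hMt (Finset.inf'_le _ (Finset.mem_univ f))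
  refine ⟨sInf S, hinf, ?_⟩
  -- (2) the gap closes above the infimum: a uniform rate would push the threshold below the infimum
  by_contra hcl
  push Not at hcl
  obtain ⟨ε, hε, hgap⟩ := hcl
  obtain ⟨δ, hδ, hP⟩ := hO (sInf S) ε hε hinf hgap
  have hmem : sInf S - δ ∈ S := hP
  have hle : sInf S ≤ sInf S - δ := csInf_le hbdd hmem
  linarith

/-! ## §2 One regularisation: the re-pin at the least admissible threshold -/

/-- **The chiral re-pin of ONE regularisation from mass continuation and a gapless tuple.**  If `reg` carries the `QCDOf`
body above `M₀`, admits mass continuation below every uniformly gapped admissible threshold, and has a tuple gapless at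
every positive rate, then for `δ :=` the least admissible threshold the δ-shifted scheme `reg.scheme (fun f => m f + δ)`
carries the body at EVERY positive tuple and is chiral at zero (for every `ε > 0` some positive tuple has no rate-`ε`
lattice gap).  `HasLatticeMassGap` reads only `β, a, L` and the bare masses, never `z, shift` (definitional). [folklore] -/
theorem chiralRepin_of_massContinuationAt {Nf : ℕ} [Nonempty (Fin Nf)] (reg : QCDRegularisation Nf) {M₀ : ℝ}
    (hbody : ∀ m : Fin Nf → ℝ, (∀ f, M₀ < m f) →
      ∃ (z shift : QCDField Nf → ℕ → ℝ) (T : OSData (QCDField Nf) 4),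
        IsQCDAlong (reg.scheme m z shift) T ∧ T.IsNontrivial QCDField.glue ∧ T.IsNonGaussian QCDField.glue ∧
          (∀ f g : Fin Nf, f ≠ g → T.IsNontrivial (QCDField.pseudoRe f g)) ∧
            ∃ Δ > 0, T.HasMassGap Δ ∧ (reg.scheme m z shift).HasLatticeMassGap Δ)
    (hO : ∀ M ε : ℝ, 0 < ε →
      (∀ m : Fin Nf → ℝ, (∀ f, M < m f) →
        ∃ (z shift : QCDField Nf → ℕ → ℝ) (T : OSData (QCDField Nf) 4),
          IsQCDAlong (reg.scheme m z shift) T ∧ T.IsNontrivial QCDField.glue ∧ T.IsNonGaussian QCDField.glue ∧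
            (∀ f g : Fin Nf, f ≠ g → T.IsNontrivial (QCDField.pseudoRe f g)) ∧
              ∃ Δ > 0, T.HasMassGap Δ ∧ (reg.scheme m z shift).HasLatticeMassGap Δ) →
      (∀ m : Fin Nf → ℝ, (∀ f, M < m f) → (reg.scheme m 0 0).HasLatticeMassGap ε) →
        ∃ δ > 0, ∀ m : Fin Nf → ℝ, (∀ f, M - δ < m f) →
          ∃ (z shift : QCDField Nf → ℕ → ℝ) (T : OSData (QCDField Nf) 4),
            IsQCDAlong (reg.scheme m z shift) T ∧ T.IsNontrivial QCDField.glue ∧ T.IsNonGaussian QCDField.glue ∧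
              (∀ f g : Fin Nf, f ≠ g → T.IsNontrivial (QCDField.pseudoRe f g)) ∧
                ∃ Δ > 0, T.HasMassGap Δ ∧ (reg.scheme m z shift).HasLatticeMassGap Δ)
    (hG : ∃ m₀ : Fin Nf → ℝ, ∀ Δ, 0 < Δ → ¬ (reg.scheme m₀ 0 0).HasLatticeMassGap Δ) :
    ∃ δ : ℝ, (∀ ε > (0 : ℝ), ∃ m : Fin Nf → ℝ, (∀ f, 0 < m f) ∧
        ¬ (reg.scheme (fun f => m f + δ) 0 0).HasLatticeMassGap ε) ∧
      ∀ m : Fin Nf → ℝ, (∀ f, 0 < m f) → ∃ (z shift : QCDField Nf → ℕ → ℝ) (T : OSData (QCDField Nf) 4),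
        IsQCDAlong (reg.scheme (fun f => m f + δ) z shift) T ∧ T.IsNontrivial QCDField.glue ∧
          T.IsNonGaussian QCDField.glue ∧ (∀ f g : Fin Nf, f ≠ g → T.IsNontrivial (QCDField.pseudoRe f g)) ∧
            ∃ Δ > 0, T.HasMassGap Δ ∧ (reg.scheme (fun f => m f + δ) z shift).HasLatticeMassGap Δ := by
  obtain ⟨M, hadm, hcl⟩ := exists_leastThreshold
    (fun m : Fin Nf → ℝ =>
      ∃ (z shift : QCDField Nf → ℕ → ℝ) (T : OSData (QCDField Nf) 4),
        IsQCDAlong (reg.scheme m z shift) T ∧ T.IsNontrivial QCDField.glue ∧ T.IsNonGaussian QCDField.glue ∧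
          (∀ f g : Fin Nf, f ≠ g → T.IsNontrivial (QCDField.pseudoRe f g)) ∧
            ∃ Δ > 0, T.HasMassGap Δ ∧ (reg.scheme m z shift).HasLatticeMassGap Δ)
    (fun m ε => (reg.scheme m 0 0).HasLatticeMassGap ε)
    (by
      -- good tuples are gapped: `HasLatticeMassGap` never reads `z, shift` (definitional)
      rintro m ⟨z, shift, T, -, -, -, -, Δ, hΔ, -, hL⟩
      exact ⟨Δ, hΔ, hL⟩)
    ⟨M₀, hbody⟩ hO hG
  refine ⟨M, fun ε hε => ?_, fun m hm => hadm (fun f => m f + M) fun f => by linarith [hm f]⟩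
  obtain ⟨m, hm, hgap⟩ := hcl ε hε
  refine ⟨fun f => m f - M, fun f => by linarith [hm f], ?_⟩
  have hm' : (fun f => m f - M + M) = m := funext fun f => by ring
  rw [hm']
  exact hgap

/-! ## §3 The registered reduction (the stub's signature VERBATIM after the two named items) -/

/-- **Stub `stub_chiralCompletion17661` from `MassContinuation` and `ChiralTupleGapless` — registered helper
`stub_chiralCompletion17661_of_massContinuation`.**  `QuarksAsStableAction.MassContinuation` (item stmt-QuantumFields-18327,
BY NAME) and `QuarksAsStableAction.ChiralTupleGapless` (item stmt-QuantumFields-18328, BY NAME) imply the registered signature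
of `stub_chiralCompletion17661` — the text of item stmt-QuantumFields-17661 `HeavyThresholdYMBridge.ChiralCompletion` —
verbatim: for `N_f ∈ {2,3}` and every mass-scaling regularisation carrying the `QCDOf` body above some threshold, the re-pin
at the least admissible threshold `M⋆` carries the body at every positive tuple and is chiral at zero (§2; `N_f ≠ 0` from
`N_f ∈ {2,3}`; mass scaling is only handed to the two items). [folklore] -/
theorem stub_chiralCompletion17661_of_massContinuation :
    Summit.QuantumFields.QCD.Theses.QuarksAsStableAction.MassContinuation →
    Summit.QuantumFields.QCD.Theses.QuarksAsStableAction.ChiralTupleGapless →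
    ∀ Nf : ℕ, Nf = 2 ∨ Nf = 3 → ∀ (reg : QCDRegularisation Nf) (M₀ : ℝ), reg.HasMassScaling →
    (∀ m : Fin Nf → ℝ, (∀ f, M₀ < m f) → ∃ (z shift : QCDField Nf → ℕ → ℝ) (T : OSData (QCDField Nf) 4),
      IsQCDAlong (reg.scheme m z shift) T ∧ T.IsNontrivial QCDField.glue ∧ T.IsNonGaussian QCDField.glue ∧
        (∀ f g : Fin Nf, f ≠ g → T.IsNontrivial (QCDField.pseudoRe f g)) ∧
          ∃ Δ > 0, T.HasMassGap Δ ∧ (reg.scheme m z shift).HasLatticeMassGap Δ) →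
    ∃ δ : ℝ, (∀ ε > (0 : ℝ), ∃ m : Fin Nf → ℝ, (∀ f, 0 < m f) ∧
        ¬ (reg.scheme (fun f => m f + δ) 0 0).HasLatticeMassGap ε) ∧
      ∀ m : Fin Nf → ℝ, (∀ f, 0 < m f) → ∃ (z shift : QCDField Nf → ℕ → ℝ) (T : OSData (QCDField Nf) 4),
        IsQCDAlong (reg.scheme (fun f => m f + δ) z shift) T ∧ T.IsNontrivial QCDField.glue ∧
          T.IsNonGaussian QCDField.glue ∧ (∀ f g : Fin Nf, f ≠ g → T.IsNontrivial (QCDField.pseudoRe f g)) ∧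
            ∃ Δ > 0, T.HasMassGap Δ ∧ (reg.scheme (fun f => m f + δ) z shift).HasLatticeMassGap Δ := by
  intro hMC hCTG Nf hNf reg M₀ hMS hbody
  haveI : NeZero Nf := ⟨by rcases hNf with rfl | rfl <;> norm_num⟩
  haveI : Nonempty (Fin Nf) := ⟨0⟩
  exact chiralRepin_of_massContinuationAt reg hbody (fun M ε hε hb hg => hMC Nf hNf reg M ε hMS hε hb hg)
    (hCTG Nf hNf reg M₀ hMS hbody)

end Summit.QuantumFields.QCD.Theorems.LightQuarkJumpLine
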